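import Summits.HodgeConjecture.HodgeCM.Model.HypCensus.DefiniteVacuumExponent_1

/-! PORT of `HodgeCM/Model/HypCensus/DefiniteVacuumExponent.lean` (HodgeCMPerL run 82) — part 2: continuation of `Summits.HodgeConjecture.HodgeCM.Model.HypCensus.DefiniteVacuumExponent_1` (split at a top-level declaration boundary by port_pkg.py; scope re-opened below; declarations unchanged). -/

-- port_pkg: scope re-opened for this part (file-level context, then the namespace/section stack open at the cut)
set_option autoImplicit false
noncomputable section
open NumberField NumberField.InfinitePlace IsDedekindDomain
open scoped Matrix
open scoped Classical TensorProduct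
open Literature.NumberTheory.Automorphic Literature.NumberTheory.Automorphic.UnitaryGroup Literature.NumberTheory.Weil1964
open Literature.RepresentationTheory.KonnoKonno2007 Literature.RepresentationTheory.KonnoKonno2007.RealDualPair
open Literature.NumberTheory.GelbartRogawski1991 Literature.NumberTheory.GelbartRogawski1991.UnitaryDualPair
open Literature.Analysis.SegalBargmann
namespace HodgeCM.Model.HypCensus
section Headline
variable (L : Type) [Field L] [NumberField L] [IsCMField L] {N M n : ℕ} (e : Fin N × Fin M ≃ Fin n)
variable (dV : Fin N → L) (hdV : ∀ i, IsCMField.complexConj L (dV i) = dV i) (hdV0 : ∀ i, dV i ≠ 0)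
variable (dW : Fin M → L) (hdW : ∀ i, IsCMField.complexConj L (dW i) = dW i) (hdW0 : ∀ i, dW i ≠ 0)
variable (hGR : (cmSplittingDatum L e dV hdV hdV0 dW hdW hdW0).CompatibleSplitting)
/-- **(c5) = (C-fix∞⊥) UNDER (S-norm), FROM SIGN FACTS.**  Under the hypotheses `(ι₁ hGR h₁V h₁W hV hW)` of
`hasThetaMajorants_cmPairSplitting_of_signs` there is ONE raw-exponent function `a : {v real} → ℤ` such that: for every pair
of unitary line characters `χ_V, χ_W` with `χ_V` of archimedean type `n_V` satisfying `n_V (w(b)) = −a b` at a real place `b`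
NOT under `ι₁`, the normalised Weil action `ω_ψ ∘ (s_pair ⊗ ((χ_V∘det_V) ⊠ (χ_W∘det_W)))` of every one-place element
`((archSingle (w b) u)^𝔸, 1)`, `u ∈ U(σ_{w(b)} diag d_V)(ℂ)`, FIXES every pure tensor `E(Φ_∞ ⊗ Φ_f)` whose archimedean factor
is the vacuum at `b` (canonical-frame image `B⁻¹G`, `G` free of `b`).  For a LINE pair (`M = 1`, the `S`-term's `(U(V), U(W_k))`)
take `h₁W := signs_fin_one (fun j => re_apply_ne_zero_of_complexConj_eq L ι₁ (hdW j) (hdW0 j))` and `hW := fun τ _ => signs_fin_one' _`;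
for the plane `M = 2` (`wmInputCM₂s`) `hW := fun τ _ => signs_fin_two fun j => re_apply_ne_zero_of_complexConj_eq L τ (hdW j) (hdW0 j)`.
[KonnoKonno2007, §3.1 (3.1); Folland1989, §4.2 (4.24) p. 156, Prop. (4.39); Knapp2002, Thm 7.39; GelbartRogawski1991, §3.1
Prop. 3.1.1 p. 455, Remark p. 457 L4–13; MoeglinVignerasWaldspurger1987, Ch. 1 I.17; Weil1964, Chap. III n° 37–39;
BorelJacquet1979, §4.1] -/
theorem exists_exponent_twist_eq_self_of_signs (ι₁ : L →+* ℂ)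
    (h₁V : ∃ i₀ : Fin N, (∀ i, i ≠ i₀ → 0 < (ι₁ (dV i)).re) ∨ ∀ i, i ≠ i₀ → (ι₁ (dV i)).re < 0)
    (h₁W : (∀ j, 0 < (ι₁ (dW j)).re) ∨ ∀ j, (ι₁ (dW j)).re < 0)
    (hV : ∀ τ : L →+* ℂ, InfinitePlace.mk τ ≠ InfinitePlace.mk ι₁ →
      (∀ i, 0 < (τ (dV i)).re) ∨ ∀ i, (τ (dV i)).re < 0)
    (hW : ∀ τ : L →+* ℂ, InfinitePlace.mk τ ≠ InfinitePlace.mk ι₁ →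
      (∃ j₀ : Fin M, ∀ j, j ≠ j₀ → 0 < (τ (dW j)).re) ∨ ∀ j, (τ (dW j)).re < 0) :
    ∃ a : {v : InfinitePlace ↥(maximalRealSubfield L) // v.IsReal} → ℤ,
      ∀ (χV χW : ContinuousMonoidHom
          (relNormOneIdeles (↥(maximalRealSubfield L)) L ⧸ relNormOneRat (↥(maximalRealSubfield L)) L) Circle)
        (nV : InfinitePlace L → ℤ), UnitaryLineChar.HasArchType L χV nV →
        ∀ b : {v : InfinitePlace ↥(maximalRealSubfield L) // v.IsReal},
          b.1 ≠ (InfinitePlace.mk ι₁).comap (algebraMap (↥(maximalRealSubfield L)) L) →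
          nV (cmPlaceOver L b).1 = -a b →
            ∀ (G : MvPolynomial (Fin n × {v : InfinitePlace ↥(maximalRealSubfield L) // v.IsReal}) ℂ),
              (∀ x ∈ G.vars, x.2 ≠ b) →
                ∀ Φinf : SchwartzMap (Fin n → mixedEmbedding.mixedSpace (↥(maximalRealSubfield L))) ℂ,
                  schwartzTransport
                      (scaledFrame (↥(maximalRealSubfield L)) (Fin n)
                        (pairScale N M (e := e)
                          (fun v => sqrtAbs (placeSignVec (cmRealVec L dV hdV) (cmSignConv L dV ι₁) v))
                          (fun v => sqrtAbs (placeSignVec (cmRealVec L dW hdW) (fun v =>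
                            ((cmPlaceOver L v).1.embedding (imagUnit L)).im / cmSignConv L dV ι₁ v) v)))
                        (pairScale_ne_zero N M
                          (fun v i => sqrtAbs_ne_zero (div_ne_zero ((map_ne_zero _).2 (ne_zero_of_isUnit_det_diagonal
                            (isUnit_det_realDiagonal L dV hdV hdV0) i)) (cmSignConv_ne_zero L dV ι₁ v)))
                          (fun v j => sqrtAbs_ne_zero (div_ne_zero ((map_ne_zero _).2 (ne_zero_of_isUnit_det_diagonal
                            (isUnit_det_realDiagonal L dW hdW hdW0) j))
                            (div_ne_zero (im_embedding_cmPlaceOver_imagUnit_ne_zero L v)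
                              (cmSignConv_ne_zero L dV ι₁ v))))))
                      Φinf = binvPi G →
                    ∀ (f : FinSB (↥(maximalRealSubfield L)) (Fin n))
                      (u : archLocal L N (Matrix.diagonal dV) (cmPlaceOver L b)),
                      cmPairRepTwist L e dV hdV hdV0 dW hdW hdW0 hGR
                          (cmDetTwistChar L dV hdV0 dW hdW0 (charOfUnitaryLineChar L χV) (charOfUnitaryLineChar L χW))
                          (archToAdelic (↥(maximalRealSubfield L)) L (IsCMField.complexConj L) N (Matrix.diagonal dV)
                            (archSingle (↥(maximalRealSubfield L)) L (IsCMField.complexConj L) N (Matrix.diagonal dV)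
                              (IsCMField.complexConj_ne_one L) (complexConj_smul_infinitePlace L) (cmPlaceOver L b) u),
                            1)
                          (piSchwartzBruhatEquiv (↥(maximalRealSubfield L)) (Fin n) (Φinf ⊗ₜ[ℂ] f)) =
                        piSchwartzBruhatEquiv (↥(maximalRealSubfield L)) (Fin n) (Φinf ⊗ₜ[ℂ] f) := by
  obtain ⟨a, ha⟩ := exists_exponent_of_signs L e dV hdV hdV0 dW hdW hdW0 hGR ι₁ h₁V h₁W hV hW
  exact ⟨a, fun χV χW nV hnV b hb hn G hG Φinf hΦ f u =>
    cmPairRepTwist_archSingle_one_tmul_eq_self L e dV hdV hdV0 dW hdW hdW0 hGR χV χW b hnV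
      (fun u => ha b hb u G hG Φinf hΦ) hn f u⟩

end Headline

end HodgeCM.Model.HypCensus

end
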